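import Summits.ResolutionOfSingularities.ResolutionOfSingularities.Theorems.TightDefectStrongWalks
import Literature.Barriers.ResolutionOfSingularities.ResidualOrderUnboundedNarrow
import HarnessLib

/-!
# FrobeniusDescent — decomp-res node (lens-5, generation 12)

[WRITER NOTE (decomp-res writer g4). The lens-5 g12 node `FrobeniusDescent` (critic row 71 / CRITIC-LEDGER line 92, CLEARED AS
STRUCTURE NODE) lands as four Theorems files: `FrobeniusDescentAlgebra` (§1, this file: Frobenius algebra on `K[y]`),
`FrobeniusDescentStates` (§2: orders, isolation, the Frobenius of a state, transport of forced walks, primitive heads),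
`FrobeniusDescentClasses` (§§3–4: the column pieces and the PROVED carve) — all Theses-free — and
`MaxContactCutFrobeniusDescent` (§5: the wiring BY NAME to the `MaxContactCut` asides).  The module docstring below is the
lens file's, verbatim.]

**Lens** «finite/base range + asymptotic regime + bridge», read on the EXPONENT axis `e` of the purely inseparable
heads `x^{pᵉ} + F(y)` of the cell's typed forced-walk model (`Theorems.TightDefectClasses`: `State`, `step`,
`IsRoot`, `ForcedWalk`, `WalksTerminate`, `DefectWalksTerminateDeep` = MaxContactCut item 31770 `DefectWalksDeep`).

**The lever (new typed object, PROVED engine).**  The FROBENIUS OF A STATE `frobState p (F, r) = (F^p, p • r)` and the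
fact that the ENTIRE forced step commutes with it for the SAME chart `j` and the SAME point `b`:
`step (p q) j b (F^p, p r) = frobState p (step q j b (F, r))` (`step_frobState`) — chart transform, translation,
cleaning of `(pq)`-th powers, the multiplicity law, the order (`ordZero_pow`), EQUIMULTIPLICITY
(`isEquimultiplePoint_frobState_iff`) and ISOLATION OF THE TOP LOCUS (`isolatedTop_pow_char_iff`, through the
Hasse–Frobenius rule `∂^{(p d)}(f^p) = (∂^{(d)} f)^p`, `topIdeal (pq) (F^p) = Frob (topIdeal q F)`) are all
Frobenius-equivariant, and shades multiply by `p` (`shade_frobState`).  Hence infinite forced walks LIFT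
(`liftWalk : ForcedWalk q s → ForcedWalk (pq) (Frob s)`) and DESCEND (`descendWalk`, same charts and points), and roots
correspond (`isRoot_frobState_iff`).  Over the perfect ground field a residual polynomial is either PRIMITIVE
(`Primitive p F`: some exponent not divisible by `p` ⟺ some `∂F/∂yᵢ ≠ 0` ⟺ the head `x^{pᵉ} + F` is a REDUCED
hypersurface) or a `p`-th power `G^p` (`exists_eq_pow_of_not_primitive`), i.e. the Frobenius of the root `(G, 0)` one
column down.

**The carve (EXACT, PROVED).**  With the columns `W_e := WalksTerminateAt p e`, `Prim_e`, `D_e`, `PrimD_e`: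
`W_{e+1} ⟺ Prim_{e+1} ∧ W_e` (`walksAt_succ_iff`), `W_0` holds (`walksTerminateAt_zero`), `Prim_1 = W_1`
(`primAt_one_iff`), the columns are ANTITONE in `e` (`walksAt_antitone`; the bad exponents of each `p` form an
UP-SET, `not_walksAt_mono`), so `WalksTerminate ⟺ PrimWalksTerminate` (`walksTerminate_iff_prim`) and
`WalksTerminate ⟺ ∀ p ∀ N ∃ e ≥ N, W_e` (`walksTerminate_iff_frequently`: the ASYMPTOTIC REGIME decides everything);
with positive tight defect: `D_{e+1} ⟺ PrimD_{e+1} ∧ D_e` (`defectAt_succ_iff`) and therefore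
`DefectWalksTerminateDeep ⟺ PrimDefectWalksTerminateDeep ∧ DefectWalksTerminateOne` (`defectDeep_iff_prim_and_one`)
and — the MODEL-FIDELITY FINDING — `DefectWalksTerminateDeep ⟺ DefectWalksTerminate ⟺ WalksTerminate`
(`defectDeep_iff_defect`, `defectDeep_iff_walks`): in the typed model the relocation of the residual to `e ≥ 2` (N51,
item 31770) is NOT a restriction, because the `e ≥ 2` columns contain the Frobenius lifts `(x^p + F)^p = x^{p²} + F^p`
of the `e = 1` column (non-reduced heads).  The faithful deep residual is `PrimDefectWalksTerminateDeep` (REDUCED heads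
of multiplicity exactly `pᵉ ≥ p²`): WEAKER than 31770 by letter (`primDefectDeep_of_defectDeep`), equivalent to it
modulo the `e = 1` model column `DefectWalksTerminateOne` [KNOWN-MOD-PORT: Cossart–Piltant 2019 Thm 1.5 (i) BY NAME
through the tree's `ShallowColumnPort` and the column-wise realisation port `ShallowRealisation`, `defectOne_of_cp`].

**Base range / asymptotic regime / bridge.**  Base = columns `e ≤ 1` (`walksAt_le_one_of_cp`, KNOWN-MOD-PORT);
bridge = Frobenius lift + descent (PROVED, both directions); asymptotic regime = `e → ∞` carries the whole problem
(`walksTerminate_iff_frequently`), and a divergent specimen at exponent `pᵉ` with an imprimitive head is a specimen at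
`p^{e-1}` in disguise (instrument hygiene: census heads at `q = pᵉ, e ≥ 2` must be PRIMITIVE; shades and Moh-type jumps
of imprimitive heads are `p ×` those one column down, `shade_st_liftWalk`).

**Honest geometric reading and prior art.**  Geometrically the dichotomy is the reduced-structure triviality
`x^{pq} + G^p = (x^q + G)^p` — caveat (d) of `Literature.Barriers.ResolutionOfSingularities.ResidualOrderUnboundedNarrow`
(«Frobenius-type pull-backs are not new geometry»; its UPWARD twist `HasDivergentPointBlowupSequence.exp_succ` via
`expand` in the Hauser–Perlega residual-order model is the sibling of `liftWalk`).  What is new here is problem-relative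
and structural: the DOWNWARD descent with the SAME walk data, the transport of ISOLATION (Hasse–Frobenius) and of the
cleaning/multiplicity law of the TightDefect model, and the resulting kernel-checked NORMALISATION of the cell's typed
classes (exact carve, `e`-monotonicity, collapse of the `e ≥ 2` relocation, primitive = reduced heads).  Ingredients in
print: Hauser–Perlega, PRIMS 60 (2024) p. 20 («if `g₀` is a `pᵉ`-th power … we may assume `g₀` is not a
`pᵉ`-th power;
then `∂_{x^k} g₀ ≠ 0` for some `0 < k < pᵉ`») and p. 24 (the maximal `k` with `in_ω(F)` a `p^k`-th power,
`∂_{y^{p^k}}` of it `= (∂_y F')^{p^k}`) [corpus: paper:hauser2024-resolving-surface-singularities-positive-characteristic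
p.20 L23–26, p.24 L14–16]; Hauser 2010 §F (cleaning); Hartshorne II.7.16 (realisation port).

**Wiring BY NAME (§5).**  `MaxContactCut.DefectWalksDeep` (31770) `⟺ PrimDefectWalksTerminateDeep ∧
DefectWalksTerminateOne`
(`defectWalksDeep_iff_prim_and_one`), `⟺ WalksTerminate` (`defectWalksDeep_iff_walksTerminate`), `⟺ PrimWalksTerminate`;
`⟸ PrimDefectWalksTerminateDeep` modulo `CossartPiltant2019LocalPermissible` + `ShallowColumnPort` + `ShallowRealisation`
(`defectWalksDeep_of_prim_cp`); necessity from 30253 `NoForcedTowers` modulo `TowerRealisation`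
(`pieces_of_noForcedTowers`); `closes` = `MaxContactCutExponentLadder.closes` (the host cone is unchanged; this node is
an aside ladder under 31770 / 30253).

Tags: engine PROVED · carve EXACT · `PrimDefectWalksTerminateDeep` UNDECIDED · located residual · IDEA-NEEDED · WEAKER by
letter · residual score 0 conceded (≡ 31770 modulo the `e = 1` port) · `DefectWalksTerminateOne` KNOWN-MOD-PORT ·
`ShallowRealisation` COSTUME(cite), counted 0.
-/

noncomputable section

open MvPolynomial
open Literature.AlgebraicGeometry.Resolution
open Literature.AlgebraicGeometry.Resolution.Hauser2010
open Literature.AlgebraicGeometry.Resolution.PointBlowup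
open Literature.Barriers.ResolutionOfSingularities.HauserPerlega
open Summit.ResolutionOfSingularities.ResolutionOfSingularities.Theorems.TightDefectClasses
open Summit.ResolutionOfSingularities.ResolutionOfSingularities.Theorems.TightDefectStrongWalks

namespace Summit.ResolutionOfSingularities.ResolutionOfSingularities.Theorems.FrobeniusDescentAlgebra

/-! ## §1 Frobenius algebra on `K[y]` in characteristic `p` (any commutative `K`) -/

section Algebra

variable {σ : Type} [DecidableEq σ] {K : Type} [CommRing K] (p : ℕ) [hp : Fact p.Prime] [CharP K p]

/-- `e ↦ e / p` coordinatewise (the exponent `d` of `y^{p d} = (y^d)^p`).  DEFINITION (support). [folklore] -/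
def divExp (p : ℕ) (e : σ →₀ ℕ) : σ →₀ ℕ :=
  Finsupp.mapRange (· / p) (Nat.zero_div p) e

omit [DecidableEq σ] hp in
/-- `p • (e / p) = e` when every coordinate of `e` is a multiple of `p`. [folklore] -/
theorem smul_divExp {e : σ →₀ ℕ} (h : ∀ i, p ∣ e i) : p • divExp p e = e := by
  ext i
  simp only [divExp, Finsupp.smul_apply, Finsupp.mapRange_apply, smul_eq_mul]
  exact Nat.mul_div_cancel' (h i)

omit [DecidableEq σ] in
/-- `(p • d) / p = d`. [folklore] -/
theorem divExp_smul (d : σ →₀ ℕ) : divExp p (p • d) = d := by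
  ext i
  simp only [divExp, Finsupp.smul_apply, Finsupp.mapRange_apply, smul_eq_mul]
  exact Nat.mul_div_cancel_left (d i) hp.out.pos

omit [DecidableEq σ] in
/-- `d ↦ p • d` is injective on exponents. [folklore] -/
theorem smul_exp_injective : Function.Injective (fun d : σ →₀ ℕ => p • d) := by
  intro d d' h
  ext i
  have := DFunLike.congr_fun h i
  simp only [Finsupp.smul_apply, smul_eq_mul] at this
  exact Nat.eq_of_mul_eq_mul_left hp.out.pos this

omit [DecidableEq σ] in
/-- `p • d ≠ 0` for `d ≠ 0`. [folklore] -/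
theorem smul_exp_ne_zero {d : σ →₀ ℕ} (hd : d ≠ 0) : p • d ≠ 0 := fun h =>
  hd (smul_exp_injective p (by simp only [h, smul_zero]))

omit [DecidableEq σ] hp in
/-- `|p • d| = p |d|`. [folklore] -/
theorem degree_smul_exp (d : σ →₀ ℕ) : (p • d).degree = p * d.degree := by
  rw [map_nsmul, smul_eq_mul]

omit [DecidableEq σ] in
/-- **… and off the lattice**: `[y^e] H^p = 0` if some `p ∤ e_i`. [folklore] -/
theorem coeff_pow_char_of_not_dvd (H : MvPolynomial σ K) {e : σ →₀ ℕ} {i : σ} (hi : ¬ p ∣ e i) :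
    coeff e (H ^ p) = 0 :=
  Literature.Barriers.ResolutionOfSingularities.coeff_pow_char_eq_zero p H e i hi

omit [DecidableEq σ] hp in
/-- An exponent that is not a `p`-th power exponent has a coordinate prime to… not divisible by `p`. [folklore] -/
theorem exists_not_dvd_of_not_isPthPowerExponent {e : σ →₀ ℕ} (h : ¬ IsPthPowerExponent p e) : ∃ i, ¬ p ∣ e i :=
  not_forall.mp fun h' => h ((isPthPowerExponent_iff _ _).mpr h')

/-- The support of `H^p` lies on the lattice over the support of `H`. [folklore] -/
theorem support_pow_char_subset (H : MvPolynomial σ K) : (H ^ p).support ⊆ H.support.image (fun d => p • d) := by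
  intro e he
  rw [mem_support_iff] at he
  by_cases hP : IsPthPowerExponent p e
  · obtain ⟨d, rfl⟩ := exists_eq_smul_of_forall_dvd ((isPthPowerExponent_iff _ _).mp hP)
    rw [Literature.Barriers.ResolutionOfSingularities.coeff_smul_pow_char K p] at he
    refine Finset.mem_image.mpr ⟨d, mem_support_iff.mpr (fun h0 => he ?_), rfl⟩
    rw [h0, zero_pow hp.out.ne_zero]
  · obtain ⟨i, hi⟩ := exists_not_dvd_of_not_isPthPowerExponent p hP
    exact (he (coeff_pow_char_of_not_dvd p H hi)).elim

omit [DecidableEq σ] in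
/-- `x^{p d}` is a `(p q)`-th power exponent iff `x^d` is a `q`-th power exponent (tree `isPthPowerExponent_smul_iff`).
[folklore] -/
theorem isPthPowerExponent_smul_iff' (q : ℕ) (d : σ →₀ ℕ) :
    IsPthPowerExponent (p * q) (p • d) ↔ IsPthPowerExponent q d :=
  isPthPowerExponent_smul_iff hp.out.ne_zero q d

/-- **Cleaning commutes with Frobenius**: `(H^p)` cleaned of `(pq)`-th powers `=` (`H` cleaned of `q`-th powers)`^p`.
[folklore] -/
theorem deletePthPowers_pow_char (q : ℕ) (H : MvPolynomial σ K) :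
    deletePthPowers (p * q) (H ^ p) = deletePthPowers q H ^ p := by
  ext e
  by_cases hP : IsPthPowerExponent p e
  · obtain ⟨d, rfl⟩ := exists_eq_smul_of_forall_dvd ((isPthPowerExponent_iff _ _).mp hP)
    simp only [coeff_deletePthPowers, Literature.Barriers.ResolutionOfSingularities.coeff_smul_pow_char K p,
      isPthPowerExponent_smul_iff' p q d]
    split_ifs
    · rw [zero_pow hp.out.ne_zero]
    · rfl
  · obtain ⟨i, hi⟩ := exists_not_dvd_of_not_isPthPowerExponent p hP
    rw [coeff_deletePthPowers, coeff_pow_char_of_not_dvd p _ hi, coeff_pow_char_of_not_dvd p _ hi]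
    split_ifs <;> rfl

omit hp in
/-- The chart exponent law is `p`-homogeneous: `chartExponent (pq) j (p d) = p • chartExponent q j d` (truncated
subtraction included: `p|d| − pq = p(|d| − q)` in `ℕ`). [folklore] -/
theorem chartExponent_smul (q : ℕ) (j : σ) (d : σ →₀ ℕ) :
    chartExponent (p * q) j (p • d) = p • chartExponent q j d := by
  ext i
  simp only [chartExponent, Finsupp.coe_update, Function.update_apply, Finsupp.smul_apply, smul_eq_mul,
    degree_smul_exp]
  split_ifs
  · rw [mul_tsub]
  · rfl

/-- **The chart transform commutes with Frobenius**: `(F^p)* = (F*)^p` (chart `y_j`, exponent `pq` vs `q`). [folklore] -/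
theorem chartTransform_pow_char (q : ℕ) (j : σ) (F : MvPolynomial σ K) :
    chartTransform (p * q) j (F ^ p) = chartTransform q j F ^ p := by
  unfold chartTransform
  rw [sum_pow_char p]
  have hinj : ∀ d ∈ F.support, ∀ d' ∈ F.support, p • d = p • d' → d = d' :=
    fun d _ d' _ h => smul_exp_injective p h
  calc ∑ e ∈ (F ^ p).support, monomial (chartExponent (p * q) j e) (coeff e (F ^ p))
      = ∑ e ∈ F.support.image (fun d => p • d), monomial (chartExponent (p * q) j e) (coeff e (F ^ p)) :=
        Finset.sum_subset (support_pow_char_subset p F) (fun e _ he => by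
          rw [notMem_support_iff.mp he, monomial_zero])
    _ = ∑ d ∈ F.support, monomial (chartExponent (p * q) j (p • d)) (coeff (p • d) (F ^ p)) :=
        Finset.sum_image hinj
    _ = ∑ d ∈ F.support, monomial (chartExponent q j d) (coeff d F) ^ p :=
        Finset.sum_congr rfl fun d _ => by
          rw [monomial_pow, chartExponent_smul, Literature.Barriers.ResolutionOfSingularities.coeff_smul_pow_char K p]

omit [DecidableEq σ] hp [CharP K p] in
/-- Translation is a ring map: `(G^n)(y + b) = (G(y + b))^n`. [folklore] -/
theorem translate_pow (b : σ → K) (G : MvPolynomial σ K) (n : ℕ) :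
    PointBlowup.translate b (G ^ n) = PointBlowup.translate b G ^ n := by
  unfold PointBlowup.translate
  exact map_pow _ _ _

omit [DecidableEq σ] in
/-- **Hasse–Frobenius rule on the lattice**: `∂^{(p d)}(f^p) = (∂^{(d)} f)^p` (the Taylor morphism is a ring map and
`(R[y])[u]` has characteristic `p`). [folklore] -/
theorem hasseDeriv_smul_pow_char (d : σ →₀ ℕ) (f : MvPolynomial σ K) :
    hasseDeriv K (p • d) (f ^ p) = hasseDeriv K d f ^ p := by
  rw [hasseDeriv_apply, hasseDeriv_apply, map_pow]
  exact Literature.Barriers.ResolutionOfSingularities.coeff_smul_pow_char (MvPolynomial σ K) p (taylor K f) d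

omit [DecidableEq σ] in
/-- **… off the lattice**: `∂^{(e)}(f^p) = 0` if some `p ∤ e_i`. [folklore] -/
theorem hasseDeriv_pow_char_of_not_dvd {e : σ →₀ ℕ} {i : σ} (hi : ¬ p ∣ e i) (f : MvPolynomial σ K) :
    hasseDeriv K e (f ^ p) = 0 := by
  rw [hasseDeriv_apply, map_pow]
  exact coeff_pow_char_of_not_dvd p (taylor K f) hi

end Algebra

end Summit.ResolutionOfSingularities.ResolutionOfSingularities.Theorems.FrobeniusDescentAlgebra
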